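import Summits.AnomalousDissipation.AnomalousDissipation.Theses.FrustratedForces
import Summits.AnomalousDissipation.AnomalousDissipation.Theorems.MirrorVarietySteadyWeakIsGlobalLerayHopf
import Summits.AnomalousDissipation.AnomalousDissipation.Theorems.MirrorVarietyFixedViscosityTransfer
import Summits.AnomalousDissipation.AnomalousDissipation.Theorems.TaylorCertificatesSteadyStatesLoudBoundedStubGpAdmissible
import Literature.Analysis.FunctionSpaces.TorusLinearisedFormTruncation

/-!
# Crux `GPLoudFamilyZ` (stmt-AnomalousDissipation-10436, route FrustratedForces, rank 4) — line `fat-half-branch`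

`Lines/fat_half_branch.lean` (crux-strategist line, registered ALONGSIDE `Lines/birth.lean`; it does not
touch the birth skeleton or its stubs).  Lens: NEGATION / OBSTRUCTION-AS-RESOURCE + STRENGTHEN.

THE OBSERVATION.  The crux asks only for LOUDNESS of some zero-mean Leray–Hopf family of the pinned
Galloway–Proctor force `f_GP = sin(2πx₂)e₀ + sin(2πx₀)e₁ + sin(2πx₁)e₂` along `ν_j → 0` — it carries NO
energy clause (energy is crux #3's business).  For a steady state loudness is power, `ν‖∇u‖² = (u,f_GP)`,
and by Poincaré on the unit torus `ν‖∇u‖² ≥ 4π²·ν‖u‖²`: EVERY steady state whose energy grows at least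
like `c/ν` ("heavy") is automatically `4π²c`-loud.  The hub already KNOWS a heavy steady family of `f_GP`
numerically: the FAT LAMINAR HALF-BRANCHES `u^±_ν = h_±/(4π²ν) + O(ν)`, `h_± = (f_GP ± curl f_GP/2π)/2`
the two ABC_{½½½} Beltrami halves of the force (`curl h_± = ±2π h_±`; each `h_±/(4π²ν)` is an EXACT
steady state of `NS_ν(h_±)`, tree `EnsembleCeiling.Negative.abc_inertial_eq_zero`), with
`∫|u_ν|² = 0.75/((2π)⁴ν²)·(1+o(1))` and power `(f_GP,u_ν) ≈ ‖h_+‖²/(4π²ν) → ∞` — LOUD AND FAT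
(Cruxes/SteadyStatesLoudBounded/Lines/lojasiewicz-lamb-floor-ladder-dead.md: kit j015722, pseudo-arclength
continuation in 2π-box units ν = 0.2 → 0.009, 15 points, NO fold, `E·ν²/0.75 → 1.00000`, each checkpoint
re-solved at a finer truncation with the same energy to 7 digits; kit j014809, pseudo-spectral Newton–Krylov
N = 24/32 on ν ∈ [0.13, 0.45]; formal series unobstructed through O(ν²): the Livšic tube data of the cell
problem `L_{h₊} w̃ = h₋` vanish by the screw symmetry of ABC, the second-order channel data by a reversing
symmetry — TRIAGE-r1-3 of that crux, kit j012861/j013313/j013601, and SYMMETRY-NOTE.md on stmt-2978).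
That branch is the object which killed every ∀-CEILING pinned on `f_GP` (dead line lojasiewicz-lamb-floor-
ladder; it makes FrustratedForces' own #2 GPSteadySubGrashof and #3 GPLoudEnergyCeilingZ numerically false —
recorded for tenure in the line card and the census, not acted on here); for THIS crux it is a WITNESS.

THE LINE (two registered stubs + kernel-checked composition `GPLoudFamilyZ_of`, sorries only in `stub_*`):

* `stub_heavySteadyGalerkinStatesGP` (EXISTENCE, the load-bearing bet, size XL): for some `c > 0`, at
  arbitrarily small viscosity `ν` the truncated steady Navier–Stokes equations of `f_GP` (tested Fourier–
  Galerkin form, verbatim the bracket of `MirrorVariety.FixedViscosityTransfer` / `GalerkinSteadyZerothLaw`)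
  have, for infinitely many resolutions `N`, a solution `U` with `ν ∫|U|² ≥ c` (energy at least `c/ν`).
  A pure ENERGY-GROWTH statement: no dissipation, no time, no Leray–Hopf.  The fat half-branch gives
  `ν∫|U|² ≍ 0.75/((2π)⁴ν) → ∞`, two decades of margin; any branch of rate `‖u‖ ≍ ν^{-a}`, `a ≥ 1/2`, fires it.
* `stub_powerFloorTransfer` (TRANSFER at fixed viscosity, general force, size M, provable now): at fixed
  `ν > 0`, a power floor `ε ≤ ν‖∇U_N‖²` on Galerkin steady states at infinitely many `N` passes to a steady
  weak solution `u ∈ V` of `NS_ν(f)` with `(u,f) ≥ ε` and the energy identity — the landed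
  `Theorems.FixedViscosityTransfer_proof` WITHOUT its energy hypothesis, which is automatic at fixed `ν`:
  the Galerkin energy identity `ν‖∇U‖² = (f,U)` (`Theorems.galerkin_energy_identity_of_tested`) with
  Cauchy–Schwarz and Poincaré (`Torus.four_pi_sq_mul_integral_norm_sq_le_gradNormSq`) gives the a-priori
  bound `∫|U|² ≤ ‖f‖₂²/(16π⁴ν²)`, so FixedViscosityTransfer applies with `E := ‖f‖₂²/(16π⁴ν²)`.

Composition (`GPLoudFamilyZ_of`, no sorry): thresholds `1/(j+1)`; `choose` from stub 1 a viscosity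
`ν_j < 1/(j+1)` (so `ν_j ≤ 1`, `ν_j → 0`) carrying heavy Galerkin states frequently in `N`; Poincaré turns
`c ≤ ν_j∫|U|²` into the power floor `4π²c ≤ ν_j‖∇U‖²` (`Frequently.mono`); stub 2 yields `u_j ∈ V`, a steady
weak solution of `NS_{ν_j}(f_GP)` with `(u_j,f_GP) ≥ 4π²c` and `ν_j‖∇u_j‖² = (u_j,f_GP)`; the landed
realisation `Theorems.steadyWeakIsGlobalLerayHopf_proof` (MirrorVariety stmt-2992) makes the constant path a
global Leray–Hopf solution from the datum `u_j ∈ H` (mean zero: `Torus.integral_eq_zero_of_mem_energySpace`)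
with `meanDissipation = ν_j‖∇u_j‖² ≥ 4π²c =: ε`; `f_GP` is admissible by the landed
`Theorems.SteadyStatesLoudBounded.GpAdmissible.stub_gpAdmissible`.

Why it dodges the STUCK point of `birth`: birth needs a ∀E FLOOR over all bounded steady states
(`stub_boundedSteadyGPStatesLoud`, Euler-coercivity of `f_GP` — open-problem grade and threatened by dodgers:
for the sibling force f₁₂₃ Lamb rigidity is numerically void above energy ≈ 4, torus-carrying drift
solutions, kit j020769/j021330) AND an ∃-bounded existence statement.  This line has NO floor stub at all:
loudness is bought from heaviness by Poincaré, and heaviness is an ∃-statement with a resolved numerical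
witness.  The two lines are logically independent and can be staffed in parallel.

Disproof used: none relevant — `ledger crux ls stmt-AnomalousDissipation-10436` shows no `Disproof.lean` and
no `Negative/` lemma for this crux (2026-08-17).  Negatives index: the refuted statements of this route
(GPEnergyCeiling stmt-2979, EnsembleCeilingBridge stmt-2984) are ANY-MEAN energy CEILINGS killed by Galilean
drift; stub 1 asserts an energy FLOOR for SOME mean-zero Galerkin steady states and stub 2 is a compactness
lemma — neither is an instance of a refuted statement.

ROUTE CONSEQUENCE (honest flag for tenure, not an action of this line): stub 1 ∧ stub 2 also give zero-mean
Leray–Hopf solutions with `meanDissipation ≥ 4π²c` and `meanEnergy = ‖u_j‖² ≥ c/ν_j → ∞`, i.e. they REFUTE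
crux #3 `GPLoudEnergyCeilingZ` at `ε₀ := 4π²c` (and the PDE shadow of stub 1 in its fat form refutes #2
`GPSteadySubGrashof`).  The route header's kill criteria already name this case ("¬#3 … ⇒ #4 is thereby
PROVED"; "¬#2 ⇒ close refuted:GPSteadySubGrashof").  The decisive open statement of route FrustratedForces is
therefore stub 1 (PDE form: heavy steady states of `f_GP` at arbitrarily small ν): TRUE ⇒ #4 proved, #2/#3
dead; its truth is what kit j015722 measures.

Hardest stub: `stub_heavySteadyGalerkinStatesGP`.  Sources: Temam1979 Ch. II Thm 1.2 / (1.29);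
ConstantinFoias1988 Ch. 8; DombreEtAl1986 (ABC flows); GallowayProctor1992 / Archontis (the force);
HoangJolly2024 = arXiv:2402.13346 §4 (Grashof expansions of steady states, `v = νu` bounded in V);
Cruxes/SteadyStatesLoudBounded/Lines/lojasiewicz-lamb-floor-ladder-dead.md (kit j015722/j014809);
Cruxes/SteadyStatesLoudBounded/STRATEGY-CENSUS.md §T7 (fat blow-down: `νu_ν → h₊/(4π²)`-type skeletons).
-/

-- `Summit.<Summit>.<Problem>` is the tree's mandated summit-side namespace (CONVENTIONS §2); for this
-- single-conjunct summit the two coincide, so the duplicate is deliberate.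
set_option linter.dupNamespace false

noncomputable section

open Filter Set Topology

namespace Summit.AnomalousDissipation.AnomalousDissipation.Cruxes.GPLoudFamilyZ.FatHalfBranch

/-- **stub 1 — heavy steady Galerkin states of the Galloway–Proctor force at arbitrarily small viscosity**
(the existence bet; size XL; load-bearing).  There is `c > 0` such that for every `ν₀ > 0` some viscosity
`ν ∈ (0, ν₀)` carries, for infinitely many resolutions `N`, a Fourier–Galerkin steady state `U` of
`NS_ν(f_GP)` — smooth, divergence-free, mean-zero, band-limited to `0 < ‖k‖∞ ≤ N`, solving the tested
Galerkin equations `∫ ⟪U,(U·∇)a⟫ + ν⟪U,Δa⟫ + ⟪f_GP,a⟫ = 0` for every band-limited smooth divergence-free `a`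
(verbatim the bracket of `MirrorVariety.FixedViscosityTransfer`) — whose energy is at least `c/ν`:
`c ≤ ν ∫|U|²`.  Why plausibly true: the fat laminar half-branch `u_ν ≈ h₊/(4π²ν)` of `NS_ν(f_GP)` (kit
j015722/j014809: `ν²∫|u_ν|² → 0.75/(2π)⁴`, no fold over 1.3 decades, truncation-converged energy) gives
`ν∫|U|² ≍ ν⁻¹`; at fixed `ν` a nondegenerate steady state is the limit of Galerkin steady states at all large
`N` (Brezzi–Rappaz–Raviart), and nondegeneracy fails only at isolated `ν` on a regular branch (three
transversal eigenvalue crossings seen, ν ≈ 0.052, 0.040, 0.019 box units).  Why it might fail: the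
half-branch could fold or dissolve below the computed range (ν_box < 0.009, Re_ABC ≳ 100) if the viscous
cell problems `(L_{h₊} − ν²Δ)w̃ = h₋ − …` lose their O(1) solvability (dynamo-type eigenvalue crossings of
the linearised operator accumulating as ν → 0), leaving only light branches — then this stub is false while
the crux may still hold through the light loud primary branch (line `birth` / route VirtualDissipation).
Leans on (for milestones, not for the statement): `Literature.Analysis.FluidPDE.galerkinRHS` /
`exists_steady_galerkin_approx` (Galerkin steady states exist ∀N), interval-Newton certification of the
K = 8 states of j015722 at fixed (ν, N), `EnsembleCeiling.Negative.abc_inertial_eq_zero` (the skeleton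
`h₊/(4π²ν)` solves `NS_ν(h₊)` exactly). -/
theorem stub_heavySteadyGalerkinStatesGP :
    ∃ c : ℝ, 0 < c ∧ ∀ ν₀ : ℝ, 0 < ν₀ → ∃ ν : ℝ, 0 < ν ∧ ν < ν₀ ∧ ∃ᶠ N in Filter.atTop, ∃ U : UnitAddTorus (Fin 3) → EuclideanSpace ℝ (Fin 3), (Literature.Analysis.FunctionSpaces.Torus.IsSmooth U ∧ Literature.Analysis.FunctionSpaces.Torus.IsDivFree U ∧ Literature.Analysis.FunctionSpaces.Torus.HasZeroMean U ∧ (∀ k ∉ (Literature.Analysis.FunctionSpaces.Torus.freqBall N).erase (0 : Fin 3 → ℤ), UnitAddTorus.mFourierCoeff (Literature.Analysis.FunctionSpaces.EuclideanSpace.complexify ∘ U) k = 0) ∧ ∀ a : UnitAddTorus (Fin 3) → EuclideanSpace ℝ (Fin 3), Literature.Analysis.FunctionSpaces.Torus.IsSmooth a → Literature.Analysis.FunctionSpaces.Torus.IsDivFree a → (∀ k ∉ (Literature.Analysis.FunctionSpaces.Torus.freqBall N).erase (0 : Fin 3 → ℤ), UnitAddTorus.mFourierCoeff (Literature.Analysis.FunctionSpaces.EuclideanSpace.complexify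 ∘ a) k = 0) → ∫ x, (inner ℝ (U x) (Literature.Analysis.FunctionSpaces.Torus.convect U a x) + ν * inner ℝ (U x) (Literature.Analysis.FunctionSpaces.Torus.laplacian a x) + inner ℝ (Literature.Analysis.FluidPDE.Torus.stokesMode (Pi.single (2 : Fin 3) (1 : ℤ)) (EuclideanSpace.single (0 : Fin 3) (1 : ℝ)) false x + Literature.Analysis.FluidPDE.Torus.stokesMode (Pi.single (0 : Fin 3) (1 : ℤ)) (EuclideanSpace.single (1 : Fin 3) (1 : ℝ)) false x + Literature.Analysis.FluidPDE.Torus.stokesMode (Pi.single (1 : Fin 3) (1 : ℤ)) (EuclideanSpace.single (2 : Fin 3) (1 : ℝ)) false x : EuclideanSpace ℝ (Fin 3)) (a x)) = 0) ∧ c ≤ ν * ∫ x, ‖U x‖ ^ 2 := by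
  sorry

/-- **stub 2 — power-floor transfer at fixed viscosity, without an energy hypothesis** (general smooth
divergence-free mean-zero force; size M; provable now).  Fix `ν > 0`.  If for infinitely many resolutions `N`
there are Galerkin steady states `U` of `NS_ν(f)` (tested form as in stub 1) with power floor
`ε ≤ ν‖∇U‖²` (`gradNormSq`), then some `u ∈ H` with `u ∈ V` is a steady weak solution of `NS_ν(f)`
(`Torus.IsSteadyWeakSolution ν f u`) with `ε ≤ (u,f)` (`Torus.pairing`) and the energy identity
`ν‖∇u‖² = (u,f)`.  This is `MirrorVariety.FixedViscosityTransfer` (stmt-2991, PROVED: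
`Theorems.FixedViscosityTransfer_proof`) minus its energy hypothesis `∫|U|² ≤ E`, which is free at fixed
`ν`: testing with `a = U` gives `ν‖∇U‖² = (f,U) ≤ ‖f‖₂ (∫|U|²)^{1/2}` (`Theorems.galerkin_energy_identity_of_tested`)
and Poincaré `4π²∫|U|² ≤ ‖∇U‖²` (`Torus.four_pi_sq_mul_integral_norm_sq_le_gradNormSq`) gives
`∫|U|² ≤ ‖f‖₂²/(16π⁴ν²) =: E`, after which `FixedViscosityTransfer_proof ν E ε f` applies verbatim.
Why it might fail: it cannot (a corollary of two landed theorems); registered as a stub because it is a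
genuine ~100–200-line lemma reusable by MirrorVariety / WindLine provers, and the cheapest de-risking target.
Leans on: `Summit.AnomalousDissipation.AnomalousDissipation.Theorems.FixedViscosityTransfer_proof`,
`…Theorems.galerkin_energy_identity_of_tested`, `Literature.Analysis.FunctionSpaces.Torus.four_pi_sq_mul_integral_norm_sq_le_gradNormSq`. -/
theorem stub_powerFloorTransfer :
    ∀ (ν ε : ℝ) (f : UnitAddTorus (Fin 3) → EuclideanSpace ℝ (Fin 3)), 0 < ν → Literature.Analysis.FunctionSpaces.Torus.IsSmooth f → Literature.Analysis.FunctionSpaces.Torus.IsDivFree f → Literature.Analysis.FunctionSpaces.Torus.HasZeroMean f → (∃ᶠ N in Filter.atTop, ∃ U : UnitAddTorus (Fin 3) → EuclideanSpace ℝ (Fin 3), (Literature.Analysis.FunctionSpaces.Torus.IsSmooth U ∧ Literature.Analysis.FunctionSpaces.Torus.IsDivFree U ∧ Literature.Analysis.FunctionSpaces.Torus.HasZeroMean U ∧ (∀ k ∉ (Literature.Analysis.FunctionSpaces.Torus.freqBall N).erase (0 : Fin 3 → ℤ), UnitAddTorus.mFourierCoeff (Literature.Analysis.FunctionSpaces.EuclideanSpace.complexify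 ∘ U) k = 0) ∧ ∀ a : UnitAddTorus (Fin 3) → EuclideanSpace ℝ (Fin 3), Literature.Analysis.FunctionSpaces.Torus.IsSmooth a → Literature.Analysis.FunctionSpaces.Torus.IsDivFree a → (∀ k ∉ (Literature.Analysis.FunctionSpaces.Torus.freqBall N).erase (0 : Fin 3 → ℤ), UnitAddTorus.mFourierCoeff (Literature.Analysis.FunctionSpaces.EuclideanSpace.complexify ∘ a) k = 0) → ∫ x, (inner ℝ (U x) (Literature.Analysis.FunctionSpaces.Torus.convect U a x) + ν * inner ℝ (U x) (Literature.Analysis.FunctionSpaces.Torus.laplacian a x) + inner ℝ (f x) (a x)) = 0) ∧ ε ≤ ν * Literature.Analysis.FunctionSpaces.Torus.gradNormSq U) → ∃ u : ↥(Literature.Analysis.FunctionSpaces.Torus.energySpace (Fin 3)), (u : MeasureTheory.Lp (EuclideanSpace ℝ (Fin 3)) 2 (MeasureTheory.volume : MeasureTheory.Measure (UnitAddTorus (Fin 3)))) ∈ Literature.Analysis.FunctionSpaces.Torus.energySpaceV (Fin 3) ∧ Literature.Analysis.FluidPDE.Torus.IsSteadyWeakSolution ν f u ∧ ε ≤ Literature.Analysis.FluidPDE.Torus.pairing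 (u : MeasureTheory.Lp (EuclideanSpace ℝ (Fin 3)) 2 (MeasureTheory.volume : MeasureTheory.Measure (UnitAddTorus (Fin 3)))) f ∧ ν * (Literature.Analysis.FunctionSpaces.Torus.eGradNormSq ((u : MeasureTheory.Lp (EuclideanSpace ℝ (Fin 3)) 2 (MeasureTheory.volume : MeasureTheory.Measure (UnitAddTorus (Fin 3)))) : UnitAddTorus (Fin 3) → EuclideanSpace ℝ (Fin 3))).toReal = Literature.Analysis.FluidPDE.Torus.pairing (u : MeasureTheory.Lp (EuclideanSpace ℝ (Fin 3)) 2 (MeasureTheory.volume : MeasureTheory.Measure (UnitAddTorus (Fin 3)))) f := by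
  sorry

/-! ## Name-keyed aliases of the two stub statements — the hypotheses of `GPLoudFamilyZ_of`

As in `Lines/birth.lean`: the native skeleton audit admits a hypothesis of the composing theorem only if its
head constant is a registered obligation or is NAMED like a declared stub; `__Registered.stub_X` is the
statement of `stub_X` verbatim (generated from the same source text), an `abbrev`. -/
namespace __Registered

/-- Alias of the statement of `stub_heavySteadyGalerkinStatesGP`, keyed by the stub name. -/
abbrev stub_heavySteadyGalerkinStatesGP : Prop :=
  ∃ c : ℝ, 0 < c ∧ ∀ ν₀ : ℝ, 0 < ν₀ → ∃ ν : ℝ, 0 < ν ∧ ν < ν₀ ∧ ∃ᶠ N in Filter.atTop, ∃ U : UnitAddTorus (Fin 3) → EuclideanSpace ℝ (Fin 3), (Literature.Analysis.FunctionSpaces.Torus.IsSmooth U ∧ Literature.Analysis.FunctionSpaces.Torus.IsDivFree U ∧ Literature.Analysis.FunctionSpaces.Torus.HasZeroMean U ∧ (∀ k ∉ (Literature.Analysis.FunctionSpaces.Torus.freqBall N).erase (0 : Fin 3 → ℤ), UnitAddTorus.mFourierCoeff (Literature.Analysis.FunctionSpaces.EuclideanSpace.complexify ∘ U) k = 0)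 ∧ ∀ a : UnitAddTorus (Fin 3) → EuclideanSpace ℝ (Fin 3), Literature.Analysis.FunctionSpaces.Torus.IsSmooth a → Literature.Analysis.FunctionSpaces.Torus.IsDivFree a → (∀ k ∉ (Literature.Analysis.FunctionSpaces.Torus.freqBall N).erase (0 : Fin 3 → ℤ), UnitAddTorus.mFourierCoeff (Literature.Analysis.FunctionSpaces.EuclideanSpace.complexify ∘ a) k = 0) → ∫ x, (inner ℝ (U x) (Literature.Analysis.FunctionSpaces.Torus.convect U a x) + ν * inner ℝ (U x) (Literature.Analysis.FunctionSpaces.Torus.laplacian a x) + inner ℝ (Literature.Analysis.FluidPDE.Torus.stokesMode (Pi.single (2 : Fin 3) (1 : ℤ)) (EuclideanSpace.single (0 : Fin 3) (1 : ℝ)) false x + Literature.Analysis.FluidPDE.Torus.stokesMode (Pi.single (0 : Fin 3) (1 : ℤ)) (EuclideanSpace.single (1 : Fin 3) (1 : ℝ)) false x + Literature.Analysis.FluidPDE.Torus.stokesMode (Pi.single (1 : Fin 3) (1 : ℤ)) (EuclideanSpace.single (2 : Fin 3) (1 : ℝ)) false x : EuclideanSpace ℝ (Fin 3)) (a x)) =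 0) ∧ c ≤ ν * ∫ x, ‖U x‖ ^ 2

/-- Alias of the statement of `stub_powerFloorTransfer`, keyed by the stub name. -/
abbrev stub_powerFloorTransfer : Prop :=
  ∀ (ν ε : ℝ) (f : UnitAddTorus (Fin 3) → EuclideanSpace ℝ (Fin 3)), 0 < ν → Literature.Analysis.FunctionSpaces.Torus.IsSmooth f → Literature.Analysis.FunctionSpaces.Torus.IsDivFree f → Literature.Analysis.FunctionSpaces.Torus.HasZeroMean f → (∃ᶠ N in Filter.atTop, ∃ U : UnitAddTorus (Fin 3) → EuclideanSpace ℝ (Fin 3), (Literature.Analysis.FunctionSpaces.Torus.IsSmooth U ∧ Literature.Analysis.FunctionSpaces.Torus.IsDivFree U ∧ Literature.Analysis.FunctionSpaces.Torus.HasZeroMean U ∧ (∀ k ∉ (Literature.Analysis.FunctionSpaces.Torus.freqBall N).erase (0 : Fin 3 → ℤ), UnitAddTorus.mFourierCoeff (Literature.Analysis.FunctionSpaces.EuclideanSpace.complexify ∘ U) k = 0) ∧ ∀ a : UnitAddTorus (Fin 3) → EuclideanSpace ℝ (Fin 3), Literature.Analysis.FunctionSpaces.Torus.IsSmooth a → Literature.Analysis.FunctionSpaces.Torus.IsDivFree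 a → (∀ k ∉ (Literature.Analysis.FunctionSpaces.Torus.freqBall N).erase (0 : Fin 3 → ℤ), UnitAddTorus.mFourierCoeff (Literature.Analysis.FunctionSpaces.EuclideanSpace.complexify ∘ a) k = 0) → ∫ x, (inner ℝ (U x) (Literature.Analysis.FunctionSpaces.Torus.convect U a x) + ν * inner ℝ (U x) (Literature.Analysis.FunctionSpaces.Torus.laplacian a x) + inner ℝ (f x) (a x)) = 0) ∧ ε ≤ ν * Literature.Analysis.FunctionSpaces.Torus.gradNormSq U) → ∃ u : ↥(Literature.Analysis.FunctionSpaces.Torus.energySpace (Fin 3)), (u : MeasureTheory.Lp (EuclideanSpace ℝ (Fin 3)) 2 (MeasureTheory.volume : MeasureTheory.Measure (UnitAddTorus (Fin 3)))) ∈ Literature.Analysis.FunctionSpaces.Torus.energySpaceV (Fin 3) ∧ Literature.Analysis.FluidPDE.Torus.IsSteadyWeakSolution ν f u ∧ ε ≤ Literature.Analysis.FluidPDE.Torus.pairing (u : MeasureTheory.Lp (EuclideanSpace ℝ (Fin 3)) 2 (MeasureTheory.volume : MeasureTheory.Measure (UnitAddTorus (Fin 3)))) f ∧ ν * (Literature.Analysis.FunctionSpaces.Torus.eGradNormSq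 ((u : MeasureTheory.Lp (EuclideanSpace ℝ (Fin 3)) 2 (MeasureTheory.volume : MeasureTheory.Measure (UnitAddTorus (Fin 3)))) : UnitAddTorus (Fin 3) → EuclideanSpace ℝ (Fin 3))).toReal = Literature.Analysis.FluidPDE.Torus.pairing (u : MeasureTheory.Lp (EuclideanSpace ℝ (Fin 3)) 2 (MeasureTheory.volume : MeasureTheory.Measure (UnitAddTorus (Fin 3)))) f

end __Registered

/-- **Composition** (kernel-checked, no `sorry` of its own): the two stub statements (as the name-keyed
aliases `__Registered.stub_*`) imply the crux
`Summit.AnomalousDissipation.AnomalousDissipation.Theses.FrustratedForces.GPLoudFamilyZ` BY NAME.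
`c` from stub 1; thresholds `1/(j+1)`; heavy Galerkin states at `ν_j < 1/(j+1)` made `4π²c`-loud by Poincaré;
stub 2 transfers the power floor to a steady weak solution `u_j ∈ V` with the energy identity; the landed
realisation theorem makes the constant path a zero-mean global Leray–Hopf solution with
`meanDissipation = ν_j‖∇u_j‖² = (u_j, f_GP) ≥ 4π²c`. [folklore] -/
theorem GPLoudFamilyZ_of :
    __Registered.stub_heavySteadyGalerkinStatesGP → __Registered.stub_powerFloorTransfer →
      Summit.AnomalousDissipation.AnomalousDissipation.Theses.FrustratedForces.GPLoudFamilyZ := by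
  intro hA hB
  dsimp only [__Registered.stub_heavySteadyGalerkinStatesGP, __Registered.stub_powerFloorTransfer] at hA hB
  obtain ⟨c, hc, hA⟩ := hA
  -- the pinned Galloway–Proctor force and its admissibility (landed)
  set F : UnitAddTorus (Fin 3) → EuclideanSpace ℝ (Fin 3) := fun x => (Literature.Analysis.FluidPDE.Torus.stokesMode (Pi.single (2 : Fin 3) (1 : ℤ)) (EuclideanSpace.single (0 : Fin 3) (1 : ℝ)) false x + Literature.Analysis.FluidPDE.Torus.stokesMode (Pi.single (0 : Fin 3) (1 : ℤ)) (EuclideanSpace.single (1 : Fin 3) (1 : ℝ)) false x + Literature.Analysis.FluidPDE.Torus.stokesMode (Pi.single (1 : Fin 3) (1 : ℤ)) (EuclideanSpace.single (2 : Fin 3) (1 : ℝ)) false x : EuclideanSpace ℝ (Fin 3)) with hF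
  obtain ⟨hs, hd, hz⟩ :
      Literature.Analysis.FunctionSpaces.Torus.IsSmooth F ∧ Literature.Analysis.FunctionSpaces.Torus.IsDivFree F ∧
        Literature.Analysis.FunctionSpaces.Torus.HasZeroMean F :=
    Summit.AnomalousDissipation.AnomalousDissipation.Theorems.SteadyStatesLoudBounded.GpAdmissible.stub_gpAdmissible
  -- thresholds `1/(j+1)`: a viscosity below the threshold carrying heavy Galerkin states, at every `j` (stub 1)
  have hθpos : ∀ j : ℕ, (0 : ℝ) < 1 / ((j : ℝ) + 1) := fun j => by positivity
  choose ν hpos hlt hfreq using fun j : ℕ => hA (1 / ((j : ℝ) + 1)) (hθpos j)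
  have hle1 : ∀ j, ν j ≤ 1 := fun j => by
    have h1 : 1 / ((j : ℝ) + 1) ≤ 1 := by
      rw [div_le_one (by positivity)]
      have hj : (0 : ℝ) ≤ (j : ℝ) := Nat.cast_nonneg j
      linarith
    exact ((hlt j).trans_le h1).le
  -- heavy ⇒ loud at the Galerkin level: Poincaré `4π² ∫|U|² ≤ ‖∇U‖²` for smooth mean-zero `U`
  have hloud : ∀ j, ∃ᶠ N in Filter.atTop, ∃ U : UnitAddTorus (Fin 3) → EuclideanSpace ℝ (Fin 3), (Literature.Analysis.FunctionSpaces.Torus.IsSmooth U ∧ Literature.Analysis.FunctionSpaces.Torus.IsDivFree U ∧ Literature.Analysis.FunctionSpaces.Torus.HasZeroMean U ∧ (∀ k ∉ (Literature.Analysis.FunctionSpaces.Torus.freqBall N).erase (0 : Fin 3 → ℤ), UnitAddTorus.mFourierCoeff (Literature.Analysis.FunctionSpaces.EuclideanSpace.complexify ∘ U) k = 0) ∧ ∀ a : UnitAddTorus (Fin 3) → EuclideanSpace ℝ (Fin 3), Literature.Analysis.FunctionSpaces.Torus.IsSmooth a → Literature.Analysis.FunctionSpaces.Torus.IsDivFree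 a → (∀ k ∉ (Literature.Analysis.FunctionSpaces.Torus.freqBall N).erase (0 : Fin 3 → ℤ), UnitAddTorus.mFourierCoeff (Literature.Analysis.FunctionSpaces.EuclideanSpace.complexify ∘ a) k = 0) → ∫ x, (inner ℝ (U x) (Literature.Analysis.FunctionSpaces.Torus.convect U a x) + ν j * inner ℝ (U x) (Literature.Analysis.FunctionSpaces.Torus.laplacian a x) + inner ℝ (F x) (a x)) = 0) ∧ 4 * Real.pi ^ 2 * c ≤ ν j * Literature.Analysis.FunctionSpaces.Torus.gradNormSq U := by
    intro j
    refine (hfreq j).mono ?_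
    rintro N ⟨U, hU, hcU⟩
    refine ⟨U, hU, ?_⟩
    have hP := Literature.Analysis.FunctionSpaces.Torus.four_pi_sq_mul_integral_norm_sq_le_gradNormSq hU.1 hU.2.2.1
    have hν : 0 ≤ ν j := (hpos j).le
    have hπ : (0 : ℝ) ≤ 4 * Real.pi ^ 2 := by positivity
    calc 4 * Real.pi ^ 2 * c ≤ 4 * Real.pi ^ 2 * (ν j * ∫ x, ‖U x‖ ^ 2) :=
          mul_le_mul_of_nonneg_left hcU hπ
      _ = ν j * (4 * Real.pi ^ 2 * ∫ x, ‖U x‖ ^ 2) := by ring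
      _ ≤ ν j * Literature.Analysis.FunctionSpaces.Torus.gradNormSq U := mul_le_mul_of_nonneg_left hP hν
  -- transfer to a loud steady weak solution in `V` with the energy identity (stub 2)
  choose u hV hsol hεu heq using fun j : ℕ => hB (ν j) (4 * Real.pi ^ 2 * c) F (hpos j) hs hd hz (hloud j)
  -- realisation: the constant path is a global Leray–Hopf solution with `meanDissipation = ν‖∇u‖²`
  have hR := fun j =>
    Summit.AnomalousDissipation.AnomalousDissipation.Theorems.steadyWeakIsGlobalLerayHopf_proof (ν j) F (u j)
      (hpos j) hs hz (hV j) (hsol j) (heq j)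
  refine ⟨4 * Real.pi ^ 2 * c, by positivity, ν,
    fun j => ((u j : MeasureTheory.Lp (EuclideanSpace ℝ (Fin 3)) 2 (MeasureTheory.volume : MeasureTheory.Measure (UnitAddTorus (Fin 3)))) : UnitAddTorus (Fin 3) → EuclideanSpace ℝ (Fin 3)),
    fun j => fun _ => ((u j : MeasureTheory.Lp (EuclideanSpace ℝ (Fin 3)) 2 (MeasureTheory.volume : MeasureTheory.Measure (UnitAddTorus (Fin 3)))) : UnitAddTorus (Fin 3) → EuclideanSpace ℝ (Fin 3)),
    fun j => ⟨hpos j, hle1 j⟩, ?_, fun j => ?_, fun j => (hR j).1, fun j => ?_⟩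
  · -- `ν_j → 0`, squeezed between `0` and `1/(j+1) → 0`
    exact tendsto_of_tendsto_of_tendsto_of_le_of_le tendsto_const_nhds tendsto_one_div_add_atTop_nhds_zero_nat
      (fun j => (hpos j).le) (fun j => (hlt j).le)
  · -- data in `H` are mean zero
    exact Literature.Analysis.FluidPDE.Torus.integral_eq_zero_of_mem_energySpace (u j).2
  · -- loudness: meanDissipation = ν‖∇u‖² = (u, f_GP) ≥ 4π²c
    rw [(hR j).2.2, heq j]
    exact hεu j

/-- WIRING CHECK: the two sorried stubs compose to a closed term of the crux's type (modulo their `sorry`s).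
Deliberately an `example` (no constant enters the environment). -/
example : Summit.AnomalousDissipation.AnomalousDissipation.Theses.FrustratedForces.GPLoudFamilyZ :=
  GPLoudFamilyZ_of stub_heavySteadyGalerkinStatesGP stub_powerFloorTransfer

end Summit.AnomalousDissipation.AnomalousDissipation.Cruxes.GPLoudFamilyZ.FatHalfBranch

end
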